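import Mathlib
import Literature.Computability.AlgebraicComplexity.Hyperdeterminant

/-!
# `DetqpThesis` (stmt-ValiantsHypothesis-0315), line `four-dimensional-determinant` — stub B2w,
# helper file: digits and tensor-product characters

Crux `Summit.ValiantsHypothesis.ValiantsHypothesis.Theses.DetQP.DetqpThesis`, line
`four-dimensional-determinant`, registered stub `stub_weightH` (B2w: a generic anti-dominant
cocharacter of the torus of the four-Borel group `H(n,m,ι)`).  This helper file holds the
bookkeeping that does not depend on the particular weight:

* `wH_weight_eq_digitSum`, `wH_digit_le` — if every variable `v` weighs `Σ_r R^{G r v}` then the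
  weight `Σ_v e_v μ_v` of an exponent `e` is the base-`R` numeral with digits
  `dig_q(e) = Σ_r Σ_{G r v = q} e_v ≤ #κ · |e|` (the several-exponent version of the route
  BorderApolarity lemma `bfba_weight_eq_digitSum`);
* `wH_prod_tensor_pow` — `∏_I (∏_r t_r(I_r))^{f I} = ∏_r ∏_i t_r(i)^{Σ_{I_r = i} f I}`;
* `wH_padded_hyperdet_weight` — the padded `ℓ`-dimensional determinant
  `X₀₀^{m-n} · rename ι (hyperdet X)` is weighted homogeneous for every weight which splits slot
  by slot on the used variables, `μ(ιI) = Σ_r w_r(I_r)`;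
* `wH_injective_of_content`, `wH_char_eq_of_content` — a weight whose level sets have constant
  "content" (exponents off the used block, slot contents `Σ_{I_r = i} e_{ιI}` on it) is injective,
  and exponents with the same content have the same character `∏_v d_v^{e_v}` for every diagonal
  `d` which is a tensor product `d(ιI) = ∏_r t_r(I_r)` on the used block.

Folklore.
-/

noncomputable section
set_option linter.dupNamespace false

namespace Summit.ValiantsHypothesis.ValiantsHypothesis.Theorems.DetQPDetqpThesis

open Literature.Computability.AlgebraicComplexity MvPolynomial
open scoped BigOperators

/-- **A several-exponent weight is a base-`R` numeral.**  With `μ_v = Σ_r R^{G r v}` and all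
exponents `< Q`: `Σ_v e_v μ_v = Σ_{q<Q} dig_q(e) R^q` where `dig_q(e) = Σ_r Σ_{G r v = q} e_v`.
[folklore] -/
theorem wH_weight_eq_digitSum {σ κ : Type} [Fintype σ] [Fintype κ] (G : κ → σ → ℕ) (R Q : ℕ)
    (hG : ∀ r v, G r v < Q) (e : σ → ℕ) :
    ∑ v, e v * ∑ r, R ^ G r v =
      ∑ q ∈ Finset.range Q, (∑ r, ∑ v ∈ Finset.univ.filter (fun v => G r v = q), e v) * R ^ q := by
  classical
  have h1 : ∀ r, ∑ v, e v * R ^ G r v =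
      ∑ q ∈ Finset.range Q, (∑ v ∈ Finset.univ.filter (fun v => G r v = q), e v) * R ^ q := by
    intro r
    rw [← Finset.sum_fiberwise_of_maps_to (s := Finset.univ) (t := Finset.range Q) (g := G r)
      (fun v _ => Finset.mem_range.2 (hG r v))]
    refine Finset.sum_congr rfl fun q _ => ?_
    rw [Finset.sum_mul]
    refine Finset.sum_congr rfl fun v hv => ?_
    rw [(Finset.mem_filter.1 hv).2]
  simp only [Finset.mul_sum]
  rw [Finset.sum_comm]
  simp only [h1, Finset.sum_mul]
  rw [Finset.sum_comm]

/-- **Digits are small**: each digit `Σ_r Σ_{G r v = q} e_v` is at most `#κ · Σ_v e_v`.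
[folklore] -/
theorem wH_digit_le {σ κ : Type} [Fintype σ] [Fintype κ] (G : κ → σ → ℕ) (e : σ → ℕ) (q : ℕ) :
    (∑ r, ∑ v ∈ Finset.univ.filter (fun v => G r v = q), e v) ≤ Fintype.card κ * ∑ v, e v := by
  classical
  calc (∑ r, ∑ v ∈ Finset.univ.filter (fun v => G r v = q), e v) ≤ ∑ _r : κ, ∑ v, e v :=
        Finset.sum_le_sum fun r _ => Finset.sum_le_sum_of_subset (Finset.filter_subset _ _)
    _ = Fintype.card κ * ∑ v, e v := by rw [Finset.sum_const, Finset.card_univ, smul_eq_mul]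

/-- **Tensor-product characters slot by slot**:
`∏_I (∏_r t_r(I_r))^{f I} = ∏_r ∏_i t_r(i)^{Σ_{I : I_r = i} f I}`. [folklore] -/
theorem wH_prod_tensor_pow {M : Type} [CommMonoid M] {k n : ℕ} (t : Fin k → Fin n → M)
    (f : (Fin k → Fin n) → ℕ) :
    ∏ I, (∏ r, t r (I r)) ^ f I =
      ∏ r, ∏ i, t r i ^ ∑ I ∈ Finset.univ.filter (fun I : Fin k → Fin n => I r = i), f I := by
  simp only [← Finset.prod_pow]
  rw [Finset.prod_comm]
  refine Finset.prod_congr rfl fun r _ => ?_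
  rw [← Finset.prod_fiberwise_of_maps_to (s := Finset.univ) (t := Finset.univ)
    (g := fun I : Fin k → Fin n => I r) (fun I _ => Finset.mem_univ _)]
  refine Finset.prod_congr rfl fun i _ => ?_
  rw [← Finset.prod_pow_eq_pow_sum]
  exact Finset.prod_congr rfl fun I hI => by rw [(Finset.mem_filter.1 hI).2]

/-- **The padded `ℓ`-dimensional determinant is weighted homogeneous** for every weight whose
values on the used variables split slot by slot, `μ(ιI) = Σ_r w_r(I_r)`: the monomial
`X₀₀^{m-n} ∏_i X_{ι(σ₀ i, …, σ_{ℓ-1} i)}` has weight `(m-n) μ₀₀ + Σ_r Σ_i w_r(i)` (reindex each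
slot by the permutation `σ_r`). [folklore] -/
theorem wH_padded_hyperdet_weight {ℓ n m : ℕ} [NeZero m] (ι : (Fin ℓ → Fin n) → Fin m × Fin m)
    (μ : Fin m × Fin m → ℤ) (w : Fin ℓ → Fin n → ℤ) (hμ : ∀ I, μ (ι I) = ∑ r, w r (I r)) :
    ∃ ν₀ : ℤ, ∀ d ∈ (X ((0 : Fin m), (0 : Fin m)) ^ (m - n) *
        rename ι (hyperdet fun I : Fin ℓ → Fin n => (X I : MvPolynomial (Fin ℓ → Fin n) ℂ))).support,
      Finsupp.weight μ d = ν₀ := by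
  classical
  set WB : ℤ := ∑ r, ∑ i, w r i with hWB
  refine ⟨(m - n) • μ (0, 0) + WB, fun d hd => ?_⟩
  have hterm : ∀ σ : Fin ℓ → Equiv.Perm (Fin n),
      IsWeightedHomogeneous μ
        (∏ i : Fin n, (X (ι fun j => σ j i) : MvPolynomial (Fin m × Fin m) ℂ)) WB := by
    intro σ
    have h := IsWeightedHomogeneous.prod (w := μ) Finset.univ
      (fun i : Fin n => (X (ι fun j => σ j i) : MvPolynomial (Fin m × Fin m) ℂ))
      (fun i => μ (ι fun j => σ j i)) (fun i _ => isWeightedHomogeneous_X _ _ _)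
    have hsum : ∑ i, μ (ι fun j => σ j i) = WB := by
      simp only [hμ]
      rw [Finset.sum_comm]
      exact Finset.sum_congr rfl fun r _ => Equiv.sum_comp (σ r) (w r)
    rwa [hsum] at h
  have hren : rename ι (hyperdet fun I : Fin ℓ → Fin n => (X I : MvPolynomial (Fin ℓ → Fin n) ℂ)) =
      hyperdet fun I : Fin ℓ → Fin n => (X (ι I) : MvPolynomial (Fin m × Fin m) ℂ) := by
    rw [← AlgHom.coe_toRingHom, map_hyperdet]
    simp only [AlgHom.coe_toRingHom, rename_X]
  have hhom : IsWeightedHomogeneous μ (X ((0 : Fin m), (0 : Fin m)) ^ (m - n) *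
      rename ι (hyperdet fun I : Fin ℓ → Fin n => (X I : MvPolynomial (Fin ℓ → Fin n) ℂ)))
      ((m - n) • μ (0, 0) + WB) := by
    refine IsWeightedHomogeneous.mul ((isWeightedHomogeneous_X _ _ _).pow (m - n)) ?_
    rw [hren]
    unfold hyperdet
    refine IsWeightedHomogeneous.sum _ _ _ fun σ _ => ?_
    rw [← Int.cast_prod, ← map_intCast (C : ℂ →+* MvPolynomial (Fin m × Fin m) ℂ)]
    exact (hterm σ).C_mul _
  exact hhom (mem_support_iff.1 hd)

/-- **Constant content on level sets makes a weight injective.**  If `μ v = μ v'` forces the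
exponents `x_v`, `x_{v'}` to agree off the used block and to have the same slot contents on it,
then `v = v'`. [folklore] -/
theorem wH_injective_of_content {k n m : ℕ} (ι : (Fin k → Fin n) → Fin m × Fin m)
    (hι : Function.Injective ι) (μ : Fin m × Fin m → ℤ)
    (h : ∀ v v' : Fin m × Fin m, μ v = μ v' →
      (∀ u, u ∉ Set.range ι →
        (Finsupp.single v 1 : Fin m × Fin m →₀ ℕ) u = (Finsupp.single v' 1 : Fin m × Fin m →₀ ℕ) u) ∧
      (∀ (r : Fin k) (i : Fin n),
        ∑ I ∈ Finset.univ.filter (fun I : Fin k → Fin n => I r = i),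
            (Finsupp.single v 1 : Fin m × Fin m →₀ ℕ) (ι I) =
          ∑ I ∈ Finset.univ.filter (fun I : Fin k → Fin n => I r = i),
            (Finsupp.single v' 1 : Fin m × Fin m →₀ ℕ) (ι I))) :
    Function.Injective μ := by
  classical
  intro v v' hvv'
  obtain ⟨hoff, hslot⟩ := h v v' hvv'
  by_cases hv : v ∈ Set.range ι
  · by_cases hv' : v' ∈ Set.range ι
    · obtain ⟨I, rfl⟩ := hv
      obtain ⟨I', rfl⟩ := hv'
      have key : ∀ (I₀ : Fin k → Fin n) (r : Fin k),
          ∑ I'' ∈ Finset.univ.filter (fun I'' : Fin k → Fin n => I'' r = I r),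
            (Finsupp.single (ι I₀) 1 : Fin m × Fin m →₀ ℕ) (ι I'') =
            if I₀ r = I r then 1 else 0 := by
        intro I₀ r
        simp only [Finsupp.single_apply, hι.eq_iff]
        rw [Finset.sum_ite_eq]
        simp only [Finset.mem_filter, Finset.mem_univ, true_and]
      suffices hII : I = I' by rw [hII]
      funext r
      have h := hslot r (I r)
      rw [key, key, if_pos rfl] at h
      by_contra hne
      rw [if_neg (Ne.symm hne)] at h
      exact one_ne_zero h
    · have h := hoff v' hv'
      rw [Finsupp.single_eq_same, Finsupp.single_apply] at h
      by_contra hne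
      rw [if_neg hne] at h
      exact zero_ne_one h
  · have h := hoff v hv
    rw [Finsupp.single_eq_same, Finsupp.single_apply] at h
    by_contra hne
    rw [if_neg (Ne.symm hne)] at h
    exact one_ne_zero h

/-- **Equal content ⇒ equal character.**  If two exponents agree off the used block and have the
same slot contents `Σ_{I_r = i} e_{ιI}` on it, then `∏_v d_v^{e_v} = ∏_v d_v^{e'_v}` for every
`d` which is a tensor product `d(ιI) = ∏_r t_r(I_r)` on the used block. [folklore] -/
theorem wH_char_eq_of_content {A : Type} [CommMonoid A] {k n m : ℕ}
    (ι : (Fin k → Fin n) → Fin m × Fin m) (hι : Function.Injective ι) (e e' : Fin m × Fin m →₀ ℕ)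
    (hoff : ∀ v, v ∉ Set.range ι → e v = e' v)
    (hslot : ∀ (r : Fin k) (i : Fin n),
      ∑ I ∈ Finset.univ.filter (fun I : Fin k → Fin n => I r = i), e (ι I) =
        ∑ I ∈ Finset.univ.filter (fun I : Fin k → Fin n => I r = i), e' (ι I))
    (d : Fin m × Fin m → A) (t : Fin k → Fin n → A) (ht : ∀ I, d (ι I) = ∏ r, t r (I r)) :
    ∏ v ∈ e.support, d v ^ e v = ∏ v ∈ e'.support, d v ^ e' v := by
  classical
  have hprod : ∀ f : Fin m × Fin m →₀ ℕ, ∏ v ∈ f.support, d v ^ f v = ∏ v, d v ^ f v := fun f =>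
    Finset.prod_subset (Finset.subset_univ _) fun v _ hv => by
      rw [Finsupp.notMem_support_iff.1 hv, pow_zero]
  have hrange : (Finset.univ.filter fun v : Fin m × Fin m => v ∈ Set.range ι) =
      Finset.univ.image ι := by
    ext v
    simp
  have hin : ∀ f : Fin m × Fin m →₀ ℕ,
      ∏ v ∈ Finset.univ.filter (fun v => v ∈ Set.range ι), d v ^ f v =
        ∏ r, ∏ i, t r i ^ ∑ I ∈ Finset.univ.filter (fun I : Fin k → Fin n => I r = i),
          f (ι I) := by
    intro f
    rw [hrange, Finset.prod_image (fun I _ I' _ h => hι h)]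
    simp only [ht]
    exact wH_prod_tensor_pow t (fun I => f (ι I))
  rw [hprod e, hprod e',
    ← Finset.prod_filter_mul_prod_filter_not Finset.univ (fun v => v ∈ Set.range ι),
    ← Finset.prod_filter_mul_prod_filter_not Finset.univ (fun v => v ∈ Set.range ι)
      (fun v => d v ^ e' v), hin e, hin e']
  congr 1
  · simp only [hslot]
  · exact Finset.prod_congr rfl fun v hv => by rw [hoff v (Finset.mem_filter.1 hv).2]

end Summit.ValiantsHypothesis.ValiantsHypothesis.Theorems.DetQPDetqpThesis

end
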